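import Summits.HodgeConjecture.CorCM.CMSixfoldRank.SimpleCMSixfoldNondegenerateHodge
import Literature.AlgebraicGeometry.Pohlmann1968.SimpleCMAbelianFourfoldPowers
import HarnessLib

/-!
# Simple complex abelian SIXFOLDS of CM type: exceptional Hodge classes occur on some power iff on the sixfold itself,
# in `H⁶` — the literal statements on the variety

Cell `pub-hodgecm2` (COR-CM), count-neutral literature seat `lit-deligne-3` gen 5; KERNEL ONLY (theorems; no
definition, no named fact, `HC_CM` not used).  The sixfold twin of
`Literature/AlgebraicGeometry/Pohlmann1968/SimpleCMAbelianFourfoldPowers.lean` (Moonen–Zarhin 1995 Thm. 2.4 / Gordon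
5.13, CM case, dimension `4`); NEW WORK in dimension `6` (hence under `Summits/`): it rests on this directory's rank
theorem (`RankAtLeastSix`: a primitive CM type on twelve embeddings has Kubota rank `≥ 6`, not in print) through
`DegreeTwelveCMTypes.le_cmTypeRank_of_finrank_eq_twelve` and lit-pohlmann's `Pohlmann1968.CorankOne`.

* §1 realisations `(A, ι, θ)` of a PRIMITIVE CM type `Φ` of a CM field of degree `12`:
  `isNondegenerate_iff_hodgeClassSpan_three_eq` (`Φ` nondegenerate ⟺ `B³(A) ⊗ ℂ = D³(A) ⊗ ℂ` — Pohlmann's criterion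
  `exists_exceptional_iff` and `exists_mem_pohlmannSets_three_diff`), `isDivisorGenerated_iff_isNondegenerate_of_finrank_eq_twelve`
  (`B(A) = D(A)` ⟺ `Φ` nondegenerate), `forall_pow_hodgeClassSpan_eq_iff_three` (Hazama's criterion reduces to `H⁶` of `A`).
* §2 on the VARIETY (`X` simple, `Milne1999.IsOfCMType X`, `dim X = 6`; no realisation data):
  `mem_divisorClassesSpan_of_ne_three_of_dim_six` (every rational `(p,p)`-class with `p ≠ 3` is a polynomial in divisor
  classes), **`isDivisorGenerated_iff_forall_powSucc_of_dim_six`** (`B(X) = D(X)` iff every power `X^{N+1}` is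
  divisor-generated), `exists_exceptional_powSucc_iff_exists_exceptional_three_of_dim_six`,
  `hodgeConjectureFor_powSucc_or_exists_exceptional_three_of_dim_six` (dichotomy: HC for all powers unconditionally,
  or `X` carries a rational `(3,3)`-class outside `D³(X) ⊗ ℂ`), `mtRank_hodge_one_eq_six_or_seven_of_dim_six`
  (`dim MT(H¹(X)) ∈ {6, 7}`), **`isDivisorGenerated_iff_mtRank_eq_seven_of_dim_six`**,
  `isDivisorGenerated_iff_forall_powSucc_hodgeConjectureFor_of_dim_six`.

## References

* [Gordon1999HodgeAVSurvey] B. B. Gordon, *A survey of the Hodge conjecture for abelian varieties*, 5.13, Thm. 6.4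
  (Hazama), 9.2–9.4 (held `paper:arxiv-alg-geom_9709030` p0017–p0018, p0024).
* [MoonenZarhin1995Duke] B. Moonen, Yu. Zarhin, Duke Math. J. 77 (1995), Thm. 2.4 (the fourfold statement imitated).
* [MoonenZarhin1999LowDim] B. Moonen, Yu. Zarhin, Math. Ann. 315 (1999), §5.
* [vanGeemen1994HodgeAV] B. van Geemen, LNM 1594 (1994), §2.4–2.5, §3.6, Thm. 6.12.
* [Dodson1987] B. Dodson, J. Algebra 111 (1987), Thm. 1.0 (held `paper:doi-10-1016-0021-8693-87-90242-0` p0003).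
* [Pohlmann1968] H. Pohlmann, Ann. of Math. 88 (1968), Thm. 1.
-/

noncomputable section

open CategoryTheory NumberField
open scoped BigOperators Pointwise Classical

namespace Summit.HodgeConjecture.CorCM.CMSixfoldRank

open Literature.NumberTheory.ComplexMultiplication
open Literature.AlgebraicGeometry Literature.AlgebraicGeometry.Motives
open Literature.AlgebraicGeometry.Motives.AbelianVariety
open Literature.AlgebraicGeometry.HodgeTheory
open Literature.AlgebraicGeometry.Pohlmann1968
open Literature.AlgebraicGeometry.ComplexMultiplication (IsCMTypeRealisation isSimple_iff_isPrimitive)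
open Literature.AlgebraicGeometry.Milne1999
open Literature.AlgebraicGeometry.VanGeemen1994 (hodgeClassSpan)
open Literature.Barriers.HodgeConjecture (divisorClassesSpan)
open Summit.HodgeConjecture.HodgeConjecture.Ring2.Atlas

/-! ### §1 Realisations of a primitive type of a CM field of degree `12` -/

section Realisation

variable {K : Type} [Field K] [NumberField K] [IsCMField K] {Φ : CMType K}
variable {A : AbelianVariety ℂ} {ι : 𝓞 K →+* End A} {θ : K →+* Module.End ℂ (complexBetti A.X 1)}

/-- **Nondegenerate ⟺ `B³(A) ⊗ ℂ = D³(A) ⊗ ℂ` on any realisation** of a primitive CM type of a CM field of degree `12`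
(Pohlmann's criterion: a rational `(3,3)`-class outside `D³ ⊗ ℂ` exists iff some balanced `6`-set is not a union of
conjugate pairs; such a set exists iff the type is degenerate, `exists_mem_pohlmannSets_three_diff`).
[cite: Gordon1999HodgeAVSurvey, 5.13 and §9.3] [cite: Pohlmann1968, Thm. 1] -/
theorem isNondegenerate_iff_hodgeClassSpan_three_eq (hK : Module.finrank ℚ K = 12) (φ₀ : K →+* ℂ)
    (hprim : IsPrimitive (ℂ ≃+* ℂ) Φ.1 φ₀) (hA : IsCMTypeRealisation Φ A ι θ) :
    IsNondegenerate Φ ↔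
      hodgeClassSpan (Module.finrank ℚ K / 2) A.X 3 = divisorClassesSpan A.X (Module.finrank ℚ K / 2) 3 := by
  refine ⟨fun hΦ => hΦ.hodgeClassSpan_eq_divisorClassesSpan hA 3, fun heq => ?_⟩
  by_contra hdeg
  obtain ⟨Δ, hΔ⟩ := exists_mem_pohlmannSets_three_diff hK φ₀ hprim hdeg
  obtain ⟨c, hcQ, hcH, hcD⟩ := (exists_exceptional_iff hA 3).2 ⟨Δ, hΔ⟩
  exact hcD (heq ▸ Submodule.subset_span ⟨hcQ, hcH⟩)

/-- **A realisation of a PRIMITIVE CM type of a CM field of degree `12` is divisor-generated iff the type is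
nondegenerate** (`Bᵖ = Dᵖ` for `p ≠ 3` always, `hodgeClassSpan_eq_divisorClassesSpan_of_ne_three`; `B³ = D³` iff
nondegenerate). [cite: Gordon1999HodgeAVSurvey, 5.13 and Thm. 6.4] [cite: vanGeemen1994HodgeAV, Thm. 6.12] -/
theorem isDivisorGenerated_iff_isNondegenerate_of_finrank_eq_twelve (hK : Module.finrank ℚ K = 12) (φ₀ : K →+* ℂ)
    (hprim : IsPrimitive (ℂ ≃+* ℂ) Φ.1 φ₀) (hA : IsCMTypeRealisation Φ A ι θ) :
    IsDivisorGenerated A ↔ IsNondegenerate Φ := by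
  rw [isDivisorGenerated_iff_forall_hodgeClassSpan_eq hA, isNondegenerate_iff_hodgeClassSpan_three_eq hK φ₀ hprim hA]
  refine ⟨fun h => h 3, fun h p => ?_⟩
  by_cases hp : p = 3
  · subst hp; exact h
  · exact hodgeClassSpan_eq_divisorClassesSpan_of_ne_three hK φ₀ hprim hA hp

/-- **No balanced quadratic endomorphism ⟹ `B(A) = D(A)` on a realisation** of a primitive type of a CM field of
degree `12` (the type is then nondegenerate, `isNondegenerate_of_not_hasBalancedQuadraticEndomorphism`).
[cite: Gordon1999HodgeAVSurvey, 5.13 (i)] [cite: MoonenZarhin1999LowDim, §5] -/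
theorem isDivisorGenerated_of_not_hasBalancedQuadraticEndomorphism_of_isCMTypeRealisation
    (hK : Module.finrank ℚ K = 12) (φ₀ : K →+* ℂ) (hprim : IsPrimitive (ℂ ≃+* ℂ) Φ.1 φ₀)
    (hA : IsCMTypeRealisation Φ A ι θ) (hn : ¬ HasBalancedQuadraticEndomorphism A) : IsDivisorGenerated A :=
  (isDivisorGenerated_iff_isNondegenerate_of_finrank_eq_twelve hK φ₀ hprim hA).2
    (isNondegenerate_of_not_hasBalancedQuadraticEndomorphism hK φ₀ hprim hA hn)

/-- **Hazama's criterion for a simple CM sixfold reduces to `H⁶` of `A` itself**: `Bᵐ(Aⁿ) ⊗ ℂ = Dᵐ(Aⁿ) ⊗ ℂ` for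
all `n, m` iff `B³(A) ⊗ ℂ = D³(A) ⊗ ℂ`. [cite: Gordon1999HodgeAVSurvey, Thm. 6.4 and 5.13] -/
theorem forall_pow_hodgeClassSpan_eq_iff_three (hK : Module.finrank ℚ K = 12) (φ₀ : K →+* ℂ)
    (hprim : IsPrimitive (ℂ ≃+* ℂ) Φ.1 φ₀) (hA : IsCMTypeRealisation Φ A ι θ) :
    (∀ n m : ℕ, hodgeClassSpan (⨁ fun _ : Fin n => A).dim (⨁ fun _ : Fin n => A).X m =
        divisorClassesSpan (⨁ fun _ : Fin n => A).X (⨁ fun _ : Fin n => A).dim m) ↔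
      hodgeClassSpan (Module.finrank ℚ K / 2) A.X 3 = divisorClassesSpan A.X (Module.finrank ℚ K / 2) 3 := by
  rw [← isNondegenerate_iff_forall_pow_hodgeClassSpan_eq φ₀ hprim hA,
    isNondegenerate_iff_hodgeClassSpan_three_eq hK φ₀ hprim hA]

end Realisation

/-! ### §2 Simple CM abelian sixfolds: the literal statements on the variety -/

section Sixfold

variable {X : AbelianVariety ℂ}

/-- **On a simple complex abelian sixfold of CM type every rational `(p,p)`-class with `p ≠ 3` is a polynomial in
divisor classes** (`Bᵖ(X) = Dᵖ(X)` for `p ≠ 3`, transported from a realisation isogenous to `X`).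
[cite: vanGeemen1994HodgeAV, Thm. 6.12 and §3.6] [cite: Gordon1999HodgeAVSurvey, 5.13] -/
theorem mem_divisorClassesSpan_of_ne_three_of_dim_six (hs : X.IsSimple) (hX6 : X.dim = 6) (hcm : IsOfCMType X)
    {p : ℕ} (hp : p ≠ 3) (c : complexBetti X.X (2 * p)) (hc : IsRationalClass c)
    (hpp : IsOfHodgeType X.dim X.X (2 * p) p p c) : c ∈ divisorClassesSpan X.X X.dim p := by
  obtain ⟨K, _, _, _, Φ, X', ι, θ, s₀, hA, hK, hprim, hiso⟩ :=
    exists_isCMTypeRealisation_of_isSimpleCMSixfold X ⟨hX6, hs, hcm⟩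
  have hd : X'.dim = Module.finrank ℚ K / 2 := schemeDim_eq_holds hA.1
  refine mem_divisorClassesSpan_of_isIsogenous_of_forall hiso p (fun c' hc' hpp' => ?_) c hc hpp
  have heq := hodgeClassSpan_eq_divisorClassesSpan_of_ne_three hK s₀ hprim hA hp
  rw [← hd] at heq
  exact heq ▸ Submodule.subset_span ⟨hc', hpp'⟩

/-- **`B(X) = D(X)` iff EVERY power `X^{N+1}` is divisor-generated**, for a simple complex abelian SIXFOLD of CM type:
exceptional Hodge classes live on `X` itself (in `H⁶`) or nowhere (a realisation `X' ∼ X` of a primitive type `Φ` of a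
CM field of degree `12`: `B(X') = D(X')` ⟺ `Φ` nondegenerate ⟺ all powers divisor-generated — Hazama; `B = D` is an
isogeny invariant). [cite: Gordon1999HodgeAVSurvey, 5.13 (i) and Thm. 6.4] [cite: vanGeemen1994HodgeAV, §3.6]
[cite: MoonenZarhin1999LowDim, §5] -/
theorem isDivisorGenerated_iff_forall_powSucc_of_dim_six (hs : X.IsSimple) (hX6 : X.dim = 6) (hcm : IsOfCMType X) :
    IsDivisorGenerated X ↔ ∀ N : ℕ, IsDivisorGenerated (X.powSucc N) := by
  refine ⟨fun h => ?_, fun h => h 0⟩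
  obtain ⟨K, _, _, _, Φ, X', ι, θ, s₀, hA, hK, hprim, hiso⟩ :=
    exists_isCMTypeRealisation_of_isSimpleCMSixfold X ⟨hX6, hs, hcm⟩
  have hX' : IsDivisorGenerated X' := h.of_isIsogenous' hiso
  have hΦ : IsNondegenerate Φ := (isDivisorGenerated_iff_isNondegenerate_of_finrank_eq_twelve hK s₀ hprim hA).1 hX'
  exact fun N => hΦ.isDivisorGenerated_powSucc_of_isIsogenous hA hiso N

/-- **Exceptional classes on some power ⟺ an exceptional class in `H⁶(X)` itself**, for a simple CM sixfold `X`.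
[cite: Gordon1999HodgeAVSurvey, 5.13 and Thm. 6.4] [cite: MoonenZarhin1999LowDim, §5] -/
theorem exists_exceptional_powSucc_iff_exists_exceptional_three_of_dim_six (hs : X.IsSimple) (hX6 : X.dim = 6)
    (hcm : IsOfCMType X) :
    (∃ (N m : ℕ) (c : complexBetti (X.powSucc N).X (2 * m)), IsRationalClass c ∧
        IsOfHodgeType (X.powSucc N).dim (X.powSucc N).X (2 * m) m m c ∧
          c ∉ divisorClassesSpan (X.powSucc N).X (X.powSucc N).dim m) ↔
      ∃ c : complexBetti X.X (2 * 3), IsRationalClass c ∧ IsOfHodgeType X.dim X.X (2 * 3) 3 3 c ∧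
        c ∉ divisorClassesSpan X.X X.dim 3 := by
  constructor
  · rintro ⟨N, m, c, hc, hmm, hcD⟩
    by_contra hno
    simp only [not_exists, not_and, not_not] at hno
    have hX : IsDivisorGenerated X := fun p c hc hpp => by
      by_cases hp : p = 3
      · subst hp; exact hno c hc hpp
      · exact mem_divisorClassesSpan_of_ne_three_of_dim_six hs hX6 hcm hp c hc hpp
    exact hcD ((isDivisorGenerated_iff_forall_powSucc_of_dim_six hs hX6 hcm).1 hX N m c hc hmm)
  · rintro ⟨c, hc, hmm, hcD⟩
    exact ⟨0, 3, c, hc, hmm, hcD⟩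

/-- **The Hodge conjecture on a simple CM sixfold — the dichotomy, literally**: EITHER every power `X^{N+1}` is
divisor-generated and satisfies the Hodge conjecture (UNCONDITIONALLY; Hazama–Murty), OR `X` itself carries a rational
`(3,3)`-class outside `D³(X) ⊗ ℂ` (the Weil classes of the forced `(3,3)` imaginary quadratic endomorphism; their
algebraicity is the remaining input `W₆`). [cite: Gordon1999HodgeAVSurvey, 5.13 (i)–(ii) and Thm. 6.4]
[cite: MoonenZarhin1999LowDim, §5] -/
theorem hodgeConjectureFor_powSucc_or_exists_exceptional_three_of_dim_six (hs : X.IsSimple) (hX6 : X.dim = 6)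
    (hcm : IsOfCMType X) :
    (∀ N : ℕ, IsDivisorGenerated (X.powSucc N) ∧ HodgeConjectureFor (X.powSucc N).dim (X.powSucc N).X) ∨
      ∃ c : complexBetti X.X (2 * 3), IsRationalClass c ∧ IsOfHodgeType X.dim X.X (2 * 3) 3 3 c ∧
        c ∉ divisorClassesSpan X.X X.dim 3 := by
  by_cases h : IsDivisorGenerated X
  · exact Or.inl fun N =>
      have hN := (isDivisorGenerated_iff_forall_powSucc_of_dim_six hs hX6 hcm).1 h N
      ⟨hN, hodgeConjectureFor_of_isDivisorGenerated _ hN⟩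
  · right
    by_contra hno
    simp only [not_exists, not_and, not_not] at hno
    exact h fun p c hc hpp => by
      by_cases hp : p = 3
      · subst hp; exact hno c hc hpp
      · exact mem_divisorClassesSpan_of_ne_three_of_dim_six hs hX6 hcm hp c hc hpp

/-- **Divisor-generated simple CM sixfolds and their powers satisfy the Hodge conjecture**: `B(X) = D(X)` iff HC holds
for every power by divisor classes. [cite: Gordon1999HodgeAVSurvey, Thm. 6.4] [cite: vanGeemen1994HodgeAV, §2.4] -/
theorem isDivisorGenerated_iff_forall_powSucc_hodgeConjectureFor_of_dim_six (hs : X.IsSimple) (hX6 : X.dim = 6)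
    (hcm : IsOfCMType X) :
    IsDivisorGenerated X ↔
      ∀ N : ℕ, IsDivisorGenerated (X.powSucc N) ∧ HodgeConjectureFor (X.powSucc N).dim (X.powSucc N).X := by
  rw [isDivisorGenerated_iff_forall_powSucc_of_dim_six hs hX6 hcm]
  exact ⟨fun h N => ⟨h N, hodgeConjectureFor_of_isDivisorGenerated _ (h N)⟩, fun h N => (h N).1⟩

variable [HodgeTensorFacts.{0, 0}] {n : ℕ} (hXn : IsSmoothProjective n X.X)

/-- **`dim MT(H¹(X)) ∈ {6, 7}` for a simple CM abelian sixfold** (this directory's rank theorem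
`six_le_typeRank_of_card_eq_twelve` and Kubota's bound, read on the variety through a realisation, Gordon 9.1).
[cite: Gordon1999HodgeAVSurvey, 9.1 and 9.4] [cite: Dodson1987, Thm. 1.0 (ii)] -/
theorem mtRank_hodge_one_eq_six_or_seven_of_dim_six (hs : X.IsSimple) (hX6 : X.dim = 6) (hcm : IsOfCMType X) :
    haveI := BettiUniverse.finite hXn 1
    (BettiUniverse.hodge exists_isReal_hodgeModel_holds hXn 1).mtRank = 6 ∨
      (BettiUniverse.hodge exists_isReal_hodgeModel_holds hXn 1).mtRank = 7 := by
  obtain ⟨K, _, _, _, Φ, X', ι, θ, s₀, hA, hiso, hK, hprim, hmt⟩ :=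
    exists_realisation_mtRank_eq hXn hs (by omega) hcm
  have h67 := cmTypeRank_eq_six_or_eq_seven (by omega) s₀ hprim
  rwa [← hmt] at h67

/-- **`B(X) = D(X)` ⟺ `dim MT(H¹(X)) = 7`, literally**, for a simple CM abelian sixfold (equivalently: all its powers are
divisor-generated; Hazama). [cite: Gordon1999HodgeAVSurvey, Thm. 6.4 and 9.4] -/
theorem isDivisorGenerated_iff_mtRank_eq_seven_of_dim_six (hs : X.IsSimple) (hX6 : X.dim = 6) (hcm : IsOfCMType X) :
    haveI := BettiUniverse.finite hXn 1
    IsDivisorGenerated X ↔ (BettiUniverse.hodge exists_isReal_hodgeModel_holds hXn 1).mtRank = 7 := by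
  rw [isDivisorGenerated_iff_forall_powSucc_of_dim_six hs hX6 hcm,
    forall_isDivisorGenerated_powSucc_iff_mtRank_eq hXn hs (by omega) hcm, hX6]

/-- **Rank `6` forces the `(3,3)` imaginary quadratic endomorphism** on a simple CM sixfold (the contrapositive of (G₀)
through the rank: `dim MT(H¹(X)) = 6 ⟹ HasBalancedQuadraticEndomorphism X`). [cite: Gordon1999HodgeAVSurvey, 5.13 (ii) and 9.4]
[cite: MoonenZarhin1999LowDim, §5] -/
theorem hasBalancedQuadraticEndomorphism_of_mtRank_eq_six (hs : X.IsSimple) (hX6 : X.dim = 6) (hcm : IsOfCMType X)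
    (h6 : haveI := BettiUniverse.finite hXn 1
      (BettiUniverse.hodge exists_isReal_hodgeModel_holds hXn 1).mtRank = 6) :
    HasBalancedQuadraticEndomorphism X := by
  by_contra hn
  have hD := isDivisorGenerated_of_not_hasBalancedQuadraticEndomorphism X ⟨hX6, hs, hcm⟩ hn
  have h7 := (isDivisorGenerated_iff_mtRank_eq_seven_of_dim_six hXn hs hX6 hcm).1 hD
  omega

end Sixfold

end Summit.HodgeConjecture.CorCM.CMSixfoldRank

end
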